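import Mathlib
import Summits.KontsevichZagierPeriods.Zeta5Search.Elimination.PencilDescentSharp
import Summits.KontsevichZagierPeriods.Zeta5Search.WedgeDictionaryCornerTransfer
import Summits.KontsevichZagierPeriods.Zeta5Search.WedgeDictionaryDiagonalShift
import Summits.KontsevichZagierPeriods.Zeta5Search.WedgeDictionaryCoeffV
import Summits.KontsevichZagierPeriods.Zeta5Search.WedgeDictionaryFaceAbel
import Summits.KontsevichZagierPeriods.Zeta5Search.DualSeriesLemma19Record
import HarnessLib

/-!
HONEST FRAMING: systematic search; no irrationality claim unless certified — identities and finite bookkeeping only.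

# Axis node of the sharpened pencil descent — data at the corner axis (E-L24, part 1 of 2)

fam-elim (class `elim`), gen 25, E-L24.  Exact bookkeeping for the node `DictPencilAxis` of
`Elimination/PencilDescentSharp.lean` (E-L23b); nothing here is an arithmetic statement about `ζ(5)`.

The hypotheses of `DictPencilAxis` force `b(a) = (n;0⁷)`, i.e. `a = aCorner n` with `n ≥ 1`.
The three points of the node then carry the parameter vectors

* `c   = bCorner n = (n; 0,0,0,0,0,0,0)`,
* `ax1 = b(a + dsUp) = (n+2; 1,1,1,1,1,1,1)`      (model `bAx1 n`),
* `ax2 = b(a + dsUp + slotDown 1) = (n+2; 0,1,1,1,1,1,1)` (model `bAx2 n`).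

This file records, for the dictionary triple `f = (U, W, V)` of `WedgeDictionary`:

* (S)  `f(ax2) = f(c) + (0, 0, (n+2)/((n+1)!)⁶)` — the rational function of `ax2` is the
  unit shift `t ↦ t+1` of the corner function (`axis_shift`);
* (DS) `f(ax1) = f(c + e₇) − (n+1)·f(c)` — the diagonal shift at the corner (`axis_ds`);
* the closed-form evaluations of the numerator polynomials of `ax1`, `ax2` and their
  slot-7 partners, used by the telescoping identities of part 2.
-/

open Finset Polynomial

namespace Summit.KontsevichZagierPeriods.Zeta5Search.Elimination

open Summit.KontsevichZagierPeriods.Zeta5Search.DualSeries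
open Summit.KontsevichZagierPeriods.Zeta5Search.WedgeDictionary
open Summit.KontsevichZagierPeriods.Zeta5Search.SymRay
open Literature.NumberTheory.Transcendental
open Literature.NumberTheory.Transcendental.BallRivoal (pfEval poch_pos pfEval_sub')
open Literature.NumberTheory.Irrationality.BrownZudilin2022 (bOfA)

/-! ## The two axis models -/

/-- Model of `b(aCorner n + dsUp) = (n+2; 1⁷)` (zero beyond slot 7, as `bOfA`). -/
def bAx1 (n : ℕ) : ℕ → ℤ := fun j => if j = 0 then (n : ℤ) + 2 else if j ≤ 7 then 1 else 0

/-- Model of `b(aCorner n + dsUp + slotDown 1) = (n+2; 0,1⁶)` (zero beyond slot 7). -/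
def bAx2 (n : ℕ) : ℕ → ℤ :=
  fun j => if j = 0 then (n : ℤ) + 2 else if j = 1 then 0 else if j ≤ 7 then 1 else 0

/-- `bAx1 n 0 = n + 2`. -/
@[simp] theorem bAx1_zero (n : ℕ) : bAx1 n 0 = (n : ℤ) + 2 := by simp [bAx1]

/-- `bAx2 n 0 = n + 2`. -/
@[simp] theorem bAx2_zero (n : ℕ) : bAx2 n 0 = (n : ℤ) + 2 := by simp [bAx2]

/-- Slots of `bAx1`: `bAx1 n (j+1) = 1` for `j < 7`. -/
theorem bAx1_succ (n : ℕ) {j : ℕ} (hj : j < 7) : bAx1 n (j + 1) = 1 := by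
  unfold bAx1
  rw [if_neg (by omega), if_pos (by omega)]

/-- Slots of `bAx2`: `bAx2 n 1 = 0`. -/
@[simp] theorem bAx2_one (n : ℕ) : bAx2 n 1 = 0 := by simp [bAx2]

/-- Slots of `bAx2`: `bAx2 n (j+2) = 1` for `j < 6`. -/
theorem bAx2_succ_succ (n : ℕ) {j : ℕ} (hj : j < 6) : bAx2 n (j + 2) = 1 := by
  unfold bAx2
  rw [if_neg (by omega), if_neg (by omega), if_pos (by omega)]

/-- `b(aCorner n + dsUp) = bAx1 n`. -/
theorem bOfA_ax1 (n : ℕ) : bOfA (aCorner n + dsUp) = bAx1 n := by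
  funext j
  match j with
  | 0 => simp [bOfA, aCorner, dsUp, bAx1]; ring
  | 1 => simp [bOfA, aCorner, dsUp, bAx1]
  | 2 => simp [bOfA, aCorner, dsUp, bAx1]
  | 3 => simp [bOfA, aCorner, dsUp, bAx1]
  | 4 => simp [bOfA, aCorner, dsUp, bAx1]
  | 5 => simp [bOfA, aCorner, dsUp, bAx1]
  | 6 => simp [bOfA, aCorner, dsUp, bAx1]
  | 7 => simp [bOfA, aCorner, dsUp, bAx1]
  | k + 8 => simp [bOfA, bAx1]

/-- `b(aCorner n + dsUp + slotDown 1) = bAx2 n`. -/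
theorem bOfA_ax2 (n : ℕ) : bOfA (aCorner n + dsUp + slotDown 1) = bAx2 n := by
  funext j
  match j with
  | 0 => simp [bOfA, aCorner, dsUp, slotDown, bAx2]; ring
  | 1 => simp [bOfA, aCorner, dsUp, slotDown, bAx2]
  | 2 => simp [bOfA, aCorner, dsUp, slotDown, bAx2]
  | 3 => simp [bOfA, aCorner, dsUp, slotDown, bAx2]
  | 4 => simp [bOfA, aCorner, dsUp, slotDown, bAx2]
  | 5 => simp [bOfA, aCorner, dsUp, slotDown, bAx2]
  | 6 => simp [bOfA, aCorner, dsUp, slotDown, bAx2]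
  | 7 => simp [bOfA, aCorner, dsUp, slotDown, bAx2]
  | k + 8 => simp [bOfA, bAx2]

/-! ## Box bookkeeping -/

/-- `bAx1 n` lies in the box. -/
theorem inBox_bAx1 (n : ℕ) : InBox (bAx1 n) := by
  refine ⟨by rw [bAx1_zero]; positivity, fun j hj => ?_⟩
  rw [bAx1_succ n (mem_range.1 hj), bAx1_zero]
  constructor <;> omega

/-- `bAx2 n` lies in the box. -/
theorem inBox_bAx2 (n : ℕ) : InBox (bAx2 n) := by
  refine ⟨by rw [bAx2_zero]; positivity, fun j hj => ?_⟩
  have hj' := mem_range.1 hj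
  rcases Nat.eq_zero_or_pos j with rfl | hpos
  · rw [Nat.zero_add, bAx2_one, bAx2_zero]; omega
  · obtain ⟨i, rfl⟩ : ∃ i, j = i + 1 := ⟨j - 1, by omega⟩
    rw [bAx2_succ_succ n (by omega), bAx2_zero]
    constructor <;> omega

/-- Slot sum of `bAx1 n` is `7`. -/
theorem sum_bAx1 (n : ℕ) : ∑ j ∈ range 7, bAx1 n (j + 1) = 7 := by
  rw [sum_congr rfl fun j hj => bAx1_succ n (mem_range.1 hj)]
  simp

/-- Slot sum of `bAx2 n` is `6`. -/
theorem sum_bAx2 (n : ℕ) : ∑ j ∈ range 7, bAx2 n (j + 1) = 6 := by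
  simp [sum_range_succ, bAx2]

/-- Slot sum of the slot-7 partner of `bAx1 n` is `8`. -/
theorem sum_bump_bAx1 (n : ℕ) : ∑ j ∈ range 7, bump (bAx1 n) 6 (j + 1) = 8 := by
  simp [sum_range_succ, bump, bAx1, Function.update]

/-- Slot sum of the slot-7 partner of `bAx2 n` is `7`. -/
theorem sum_bump_bAx2 (n : ℕ) : ∑ j ∈ range 7, bump (bAx2 n) 6 (j + 1) = 7 := by
  simp [sum_range_succ, bump, bAx2, Function.update]

/-- `(bAx1 n 0).toNat = n + 2`. -/
theorem bAx1_zero_toNat (n : ℕ) : (bAx1 n 0).toNat = n + 2 := by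
  rw [bAx1_zero]; omega

/-- `(bAx2 n 0).toNat = n + 2`. -/
theorem bAx2_zero_toNat (n : ℕ) : (bAx2 n 0).toNat = n + 2 := by
  rw [bAx2_zero]; omega

/-! ## Numerator polynomials in closed form -/

/-- `numPoly (bAx1 n)` at `x`: `(2x+n+2)·(x(x+n+2))⁷`. -/
theorem eval_numPoly_bAx1 (n : ℕ) (x : ℚ) :
    (numPoly (bAx1 n)).eval x = (2 * x + (n + 2)) * (x * (x + (n + 2))) ^ 7 := by
  have hf : ∀ j ∈ range 7, BallRivoal.poch x (bAx1 n (j + 1)).toNat *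
      BallRivoal.poch (x + ((bAx1 n 0 - bAx1 n (j + 1) + 1 : ℤ) : ℚ)) (bAx1 n (j + 1)).toNat =
        x * (x + (n + 2)) := by
    intro j hj
    rw [bAx1_succ n (mem_range.1 hj), bAx1_zero]
    simp [BallRivoal.poch]
  rw [eval_numPoly, prod_congr rfl hf, prod_const, card_range, bAx1_zero]
  push_cast; ring

/-- `numPoly (bAx2 n)` at `x`: `(2x+n+2)·(x(x+n+2))⁶`. -/
theorem eval_numPoly_bAx2 (n : ℕ) (x : ℚ) :
    (numPoly (bAx2 n)).eval x = (2 * x + (n + 2)) * (x * (x + (n + 2))) ^ 6 := by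
  have hf : ∀ j ∈ range 6, BallRivoal.poch x (bAx2 n (j + 1 + 1)).toNat *
      BallRivoal.poch (x + ((bAx2 n 0 - bAx2 n (j + 1 + 1) + 1 : ℤ) : ℚ)) (bAx2 n (j + 1 + 1)).toNat =
        x * (x + (n + 2)) := by
    intro j hj
    rw [show j + 1 + 1 = j + 2 from rfl, bAx2_succ_succ n (mem_range.1 hj), bAx2_zero]
    simp [BallRivoal.poch]
  rw [eval_numPoly, prod_range_succ', prod_congr rfl hf, prod_const, card_range, Nat.zero_add, bAx2_one,
    bAx2_zero, Int.toNat_zero]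
  simp only [BallRivoal.poch, prod_range_zero, mul_one]
  push_cast; ring

/-- `numPoly` of the slot-7 partner of `bAx1 n` at `x`. -/
theorem eval_numPoly_bump_bAx1 (n : ℕ) (x : ℚ) :
    (numPoly (bump (bAx1 n) 6)).eval x =
      (2 * x + (n + 2)) * (x * (x + (n + 2))) ^ 7 * ((x + 1) * (x + (n + 1))) := by
  have e := numPoly_update (bAx1 n) (i := 6) (mem_range.2 (by norm_num))
    (by rw [bAx1_succ n (by norm_num)]; norm_num)
  rw [show Function.update (bAx1 n) (6 + 1) (bAx1 n (6 + 1) + 1) = bump (bAx1 n) 6 from rfl] at e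
  rw [e, eval_mul, eval_numPoly_bAx1, bAx1_succ n (by norm_num), bAx1_zero]
  simp only [eval_mul, eval_add, eval_X, eval_C]
  push_cast; ring

/-- `numPoly` of the slot-7 partner of `bAx2 n` at `x`. -/
theorem eval_numPoly_bump_bAx2 (n : ℕ) (x : ℚ) :
    (numPoly (bump (bAx2 n) 6)).eval x =
      (2 * x + (n + 2)) * (x * (x + (n + 2))) ^ 6 * ((x + 1) * (x + (n + 1))) := by
  have e := numPoly_update (bAx2 n) (i := 6) (mem_range.2 (by norm_num))
    (by rw [show (6 : ℕ) + 1 = 5 + 2 from rfl, bAx2_succ_succ n (by norm_num)]; norm_num)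
  rw [show Function.update (bAx2 n) (6 + 1) (bAx2 n (6 + 1) + 1) = bump (bAx2 n) 6 from rfl] at e
  rw [e, eval_mul, eval_numPoly_bAx2, show (6 : ℕ) + 1 = 5 + 2 from rfl, bAx2_succ_succ n (by norm_num),
    bAx2_zero]
  simp only [eval_mul, eval_add, eval_X, eval_C]
  push_cast; ring

/-! ## (S) The unit shift: `f(ax2)` from `f(c)` -/

/-- The data identity `pfData ax2 = pad (shift (pfData c))` on the support. -/
theorem axis_shift_data (n : ℕ) {o p : ℕ} (ho : o < 6) (hp : p ≤ n + 2) :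
    pfData (bAx2 n) o p = padData (n + 1) (shiftUp (pfData (bCorner n))) o p := by
  have hB := inBox_bAx2 n
  have hs : ∑ j ∈ range 7, bAx2 n (j + 1) ≤ 3 * bAx2 n 0 + 1 := by rw [sum_bAx2, bAx2_zero]; omega
  refine sub_eq_zero.1 (data_eq_zero_of_pfEval_zero (n + 2) 6
    (fun o p => pfData (bAx2 n) o p - padData (n + 1) (shiftUp (pfData (bCorner n))) o p)
    (fun t => ?_) ho hp)
  have F := pfEval_pfData_eq (bAx2 n) hB hs (t : ℚ) (fun p _ => by positivity)
  rw [bAx2_zero_toNat] at F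
  have hP := poch_pos (show (0 : ℚ) < (t : ℚ) + 1 + 1 by positivity) (n + 1)
  rw [pfEval_sub', pfEval_padData (by omega), pfEval_shiftUp, F,
    pfEval_corner n ((t : ℚ) + 1) (fun p _ => by positivity), poch_add_three, eval_comp,
    eval_add, eval_X, eval_C, eval_numPoly_bAx2, div_sub_div _ _ (by positivity) (by positivity),
    div_eq_zero_iff]
  left
  push_cast
  ring

/-- (S) `U(ax2) = U(c)`, `W(ax2) = W(c)`, `V(ax2) = V(c) + (n+2)/((n+1)!)⁶`. -/
theorem axis_shift (n : ℕ) :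
    coeffU (bAx2 n) = coeffU (bCorner n) ∧ coeffW (bAx2 n) = coeffW (bCorner n) ∧
      coeffV (bAx2 n) = coeffV (bCorner n) + ((n : ℚ) + 2) / BallRivoal.poch 1 (n + 1) ^ 6 := by
  have hsum : ∀ o, o < 6 → ∑ p ∈ range (n + 2 + 1), pfData (bAx2 n) o p =
      ∑ p ∈ range (n + 1), pfData (bCorner n) o p := by
    intro o ho
    rw [sum_congr rfl fun p hp => axis_shift_data n ho (by have := mem_range.1 hp; omega),
      sum_padData (show n + 1 ≤ n + 2 by omega), show n + 1 + 1 = n + 2 from rfl, sum_shiftUp]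
  refine ⟨?_, ?_, ?_⟩
  · unfold coeffU
    rw [bAx2_zero_toNat, bCorner_zero_toNat, hsum 4 (by norm_num)]
  · unfold coeffW
    rw [bAx2_zero_toNat, bCorner_zero_toNat, hsum 2 (by norm_num)]
  · have hE : Vfun (n + 2) 6 (pfData (bAx2 n)) =
        Vfun (n + 2) 6 (padData (n + 1) (shiftUp (pfData (bCorner n)))) := by
      unfold Vfun
      refine sum_congr rfl fun o ho => sum_congr rfl fun p hp => ?_
      rw [axis_shift_data n (mem_range.1 ho) (by have := mem_range.1 hp; omega)]
    rw [coeffV_eq_Vfun, coeffV_eq_Vfun, bAx2_zero_toNat, bCorner_zero_toNat, hE,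
      Vfun_padData (by omega), Vfun_shiftUp, pfEval_corner n 0 (fun p _ => by positivity)]
    simp only [mul_zero, zero_add]

/-! ## (DS) The diagonal shift at the corner -/

/-- (DS) `f(ax1) = f(c + e₇) − (n+1)·f(c)` for `f ∈ {U, W, V}`. -/
theorem axis_ds (n : ℕ) :
    coeffU (bAx1 n) = coeffU (bump (bCorner n) 6) - ((n : ℚ) + 1) * coeffU (bCorner n) ∧
    coeffW (bAx1 n) = coeffW (bump (bCorner n) 6) - ((n : ℚ) + 1) * coeffW (bCorner n) ∧
    coeffV (bAx1 n) = coeffV (bump (bCorner n) 6) - ((n : ℚ) + 1) * coeffV (bCorner n) := by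
  have hd : 0 ≤ dOf (bCorner n) := by rw [dOf_bCorner]; positivity
  obtain ⟨hU, hW, hV⟩ := dictionary_dsShift (bCorner n) (inBox_bCorner n) hd (i := 6)
    (mem_range.2 (by norm_num)) (by simp [bCorner])
  have hlam : dsLam (bCorner n) 6 = (n : ℚ) + 1 := by simp [dsLam, bCorner]
  have h0 : dsShift (bCorner n) 0 = bAx1 n 0 := by simp [dsShift, bCorner]
  have hnum : numPoly (dsShift (bCorner n)) = numPoly (bAx1 n) :=
    numPoly_congr fun j hj => by
      rcases Nat.eq_zero_or_pos j with rfl | hpos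
      · simp [dsShift, bCorner]
      · obtain ⟨i, rfl⟩ : ∃ i, j = i + 1 := ⟨j - 1, by omega⟩
        rw [bAx1_succ n (by omega)]
        simp [dsShift, bCorner]
  rw [coeffU_congr' h0 hnum, hlam] at hU
  rw [coeffW_congr' h0 hnum, hlam] at hW
  rw [DualSeriesLemma19.coeffV_congr' h0 hnum, hlam] at hV
  exact ⟨hU, hW, hV⟩

end Summit.KontsevichZagierPeriods.Zeta5Search.Elimination
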